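import Mathlib
import Summits.KontsevichZagierPeriods.Zeta5Search.ThirdOrderTransfer
import Summits.KontsevichZagierPeriods.Zeta5Search.FourthOrderShapeData
import Summits.KontsevichZagierPeriods.Zeta5Search.RecordWindowsA4
import Summits.KontsevichZagierPeriods.Zeta5Search.CellKitRays
import HarnessLib

/-!
# ζ(5) search — THEOREM L5: transport of the shape clause (T4) to `b + e_j` (`H6_shift`), and the frame from `b` alone

Cell `pub-zeta5` (HONEST FRAMING: systematic search; no irrationality claim unless certified), typer seat generation 13.
REPORT-gen2-g14 §4 bookkeeping, the L5 analogue of typer g12's `H5_shift`: if `b` satisfies the class clauses `LawA4Classes b p M T`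
and the shape clause `ShapeClause b p M T`, then so does `b + e_j`.  A pole class `z` of `b + e_j` with `ν = −M + 3` is unhit
(its list is that of `b`, clause (T4) for `b`), hit once (then `E_z(b) = −M + 2`, its `b`-list is an admissible double raise of `T`
by (T3), and the hit raises one more level: a degree-3 T-shape, `isRaiseN_raiseAtList`), or hit twice (then `E_z(b) = −M + 1`; by
(T2) its `b`-list is a single raise of `T` — two more raises give a degree-3 T-shape — or `z` is the odd-centre class of type `T`,
which stays odd-centre with a degree-2 T-shape).  Consequences: `lawA4Classes_shift` (bundling typer g11/g12's `H1_shift`–`H5_shift`),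
`shapeClause_shift`, and `recFrameL5_of_unshifted`: the L5 frame `RecFrameL5 n p M T` of the record ray follows from the clauses of
the UNSHIFTED datum `bRec n` alone.  Bookkeeping only; nothing here bears on irrationality.
-/

noncomputable section

open Finset PowerSeries

namespace Summit.KontsevichZagierPeriods.Zeta5Search.SecondOrder

open Summit.KontsevichZagierPeriods.Zeta5Search.DualSeries (InBox)
open Summit.KontsevichZagierPeriods.Zeta5Search.CasoratianValuation (InPolytope shift)
open Summit.KontsevichZagierPeriods.Zeta5Search.ClusterValuation
open Summit.KontsevichZagierPeriods.Zeta5Search.BigPrime (shift_zero)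
open Summit.KontsevichZagierPeriods.Zeta5Search.CellKit (two_mul_le_of_shift classExp_shift_eq unhit_of_classExp_eq netExp_shift_of_unhit)
open Summit.KontsevichZagierPeriods.Zeta5Search.RecordWindowsA4 (LawA4Classes)
open Summit.KontsevichZagierPeriods.Zeta5Search.SecondResidueLaw (isRaiseN ShapeClause RecFrameL5)

variable {p : ℕ} [hp : Fact p.Prime]

/-! ## §1 One more raise of a `k`-fold raise -/

omit hp in
/-- **Raising one level of a degree-`k` T-shape gives a degree-`k+1` T-shape.** -/
theorem isRaiseN_raiseAtList : ∀ (k : ℕ) (T S : List ℤ) (ℓ : ℕ), isRaiseN k T S = true → ℓ < S.length →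
    isRaiseN (k + 1) T (raiseAtList S ℓ) = true := by
  intro k
  induction k with
  | zero =>
    intro T S ℓ h hℓ
    have hST : S = T := (isRaiseN_zero_iff T S).1 h
    subst hST
    exact (isRaiseN_succ_iff 0 S _).2 (Or.inl ⟨ℓ, hℓ, (isRaiseN_zero_iff _ _).2 rfl⟩)
  | succ k ih =>
    intro T S ℓ h hℓ
    rcases (isRaiseN_succ_iff k T S).1 h with ⟨i, hi, hU⟩ | hU | hU
    · exact (isRaiseN_succ_iff (k + 1) T _).2 (Or.inl ⟨i, hi, ih _ S ℓ hU hℓ⟩)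
    · exact (isRaiseN_succ_iff (k + 1) T _).2 (Or.inr (Or.inl (ih _ S ℓ hU hℓ)))
    · exact (isRaiseN_succ_iff (k + 1) T _).2 (Or.inr (Or.inr (ih _ S ℓ hU hℓ)))

/-! ## §2 Transport of the shape clause -/

section Transport

variable (b : ℕ → ℤ) {j : ℕ} (hb : InPolytope b) (hb' : InPolytope (shift b j)) (hj1 : 1 ≤ j) (hj7 : j ≤ 7)
  (hpn : (p : ℤ) ≤ b 0) {M : ℕ} (hM : 6 ≤ M) {T : List ℤ} (hC : LawA4Classes b p M T) (hS : ShapeClause b p M T)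
include hb hb' hj1 hj7 hpn hM hC

omit hS in
/-- **The class clauses transport** (typer g11/g12's `H1_shift`–`H5_shift`, bundled). -/
theorem lawA4Classes_shift : LawA4Classes (shift b j) p M T := by
  obtain ⟨H1, H2, H3, H4, H5⟩ := hC
  exact ⟨H1_shift b hb hj1 H1, H2_shift b hb hb' hj1 hj7 hM H1 H2, H3_shift b hb hb' hj1 hj7 hpn H1 H3,
    H4_shift b hb hb' hj1 hj7 hpn hM H1 H2 H3 H4, H5_shift b hb hb' hj1 hj7 hpn hM H1 H2 H3 H4 H5⟩

include hS in
/-- **H6: the shape clause (T4) transports to `b + e_j`.** -/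
theorem shapeClause_shift : ShapeClause (shift b j) p M T := by
  obtain ⟨H1, H2, H3, H4, H5⟩ := hC
  intro z hz h1 hnu
  have h0 : 0 ≤ b 0 := hb.1.1
  have hp0 : 0 < p := hp.out.pos
  have hzn : z ≤ (b 0).toNat := le_b0_of_lt b hpn hz
  have hcb := classPoleCount_shift_le b hb.1 hj1 p z
  have tame_nonneg : ∀ {c : ℕ → ℤ}, classPoleCount c p z = 1 → tameSingle c p z = true → 0 ≤ classNu c p z := by
    intro c h1' ht'; unfold classNu; rw [if_pos ⟨h1', ht'⟩]; exact le_max_right _ _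
  have hEq : classNu (shift b j) p z = classExp (shift b j) p z := by
    by_contra hne
    have := (tame_of_classNu_ne (shift b j) hne).2; omega
  have hE' : classExp (shift b j) p z = -(M : ℤ) + 3 := by rw [← hEq]; exact hnu
  have not_tame : ¬ (classPoleCount b p z = 1 ∧ tameSingle b p z = true) := by
    rintro ⟨h1b, ht⟩
    have ht' := tameSingle_shift b hb hb' hj1 hj7 h1b h1 ht
    have := tame_nonneg (by omega) ht'
    omega
  have hνb : classNu b p z = classExp b p z := by
    unfold classNu; rw [if_neg not_tame]
  have h1b : 1 ≤ classPoleCount b p z := le_trans h1 hcb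
  by_cases heq : classExp (shift b j) p z = classExp b p z
  · -- unhit: everything transports
    rw [classTypeList_shift_of_unhit b hb hb' hj1 hj7 heq hzn]
    rcases hS z hz h1b (by rw [hνb, ← heq, hE']) with h | ⟨hodd, hcen, h⟩
    · exact Or.inl h
    · exact Or.inr ⟨by rw [shift_zero b hj1]; exact hodd, by unfold CentreIn; rw [shift_zero b hj1]; exact hcen, h⟩
  -- hit: the moved points in the class
  have h2 := two_mul_le_of_shift b hj1 hj7 hb'
  have hsum := classExp_shift_eq b hb hj1 hj7 hb' p z
  set k₁ := (b j).toNat with hk₁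
  set N := (b 0).toNat with hN
  set mv : ℕ → Prop := fun s => s = k₁ ∨ s = N - k₁ with hmv
  have hcnt : classExp (shift b j) p z = classExp b p z + (((classSet b p z).filter mv).card : ℤ) := by
    rw [hsum, ← sum_boole]
  have hcard_le : ((classSet b p z).filter mv).card ≤ 2 := by
    calc ((classSet b p z).filter mv).card ≤ ({k₁, N - k₁} : Finset ℕ).card :=
          card_le_card fun s hs => by
            rcases (mem_filter.1 hs).2 with h | h
            · rw [h]; exact mem_insert_self _ _
            · rw [h]; exact mem_insert_of_mem (mem_singleton_self _)
      _ ≤ 2 := card_le_two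
  have hcard_pos : 1 ≤ ((classSet b p z).filter mv).card := by
    by_contra h0c
    apply heq; rw [hcnt]; have : ((classSet b p z).filter mv).card = 0 := by omega
    rw [this]; simp
  obtain ⟨hL, hL'⟩ := level_bounds' (p := p) b hzn
  set L := topLevel b p z with hLdef
  set f : ℕ → ℤ := fun k => netExp b (z + k * p) with hfdef
  have htop : topLevel (shift b j) p z = L := by rw [hLdef]; unfold topLevel; rw [shift_zero b hj1]
  have hSb : classTypeList b p z = (List.range (L + 1)).map f := classTypeList_level b hL hL'
  have hlenb : (classTypeList b p z).length = L + 1 := by rw [hSb]; simp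
  -- levels of the moved points
  have lev_of_mem : ∀ {s}, s ∈ classSet b p z → ∃ ℓ ≤ L, s = z + ℓ * p := fun {s} hs => by
    rw [LevelClass.classSet_level b hz hL hL'] at hs
    obtain ⟨ℓ, hℓ, rfl⟩ := mem_image.1 hs
    exact ⟨ℓ, by have := mem_range.1 hℓ; omega, rfl⟩
  have hnew : ∀ ℓ ≤ L, netExp (shift b j) (z + ℓ * p) = f ℓ + (if mv (z + ℓ * p) then 1 else 0) := fun ℓ _ => by
    rw [CellA.netExp_shift_eq b hb.1 hj1 hj7 h2]
  rcases (show ((classSet b p z).filter mv).card = 1 ∨ ((classSet b p z).filter mv).card = 2 by omega) with hc1 | hc2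
  · -- ### hit once: `E_z(b) = −M + 2`, the `b`-list is an admissible double raise, raised once more
    obtain ⟨s₀, hs₀⟩ := card_eq_one.1 hc1
    have hs₀mem : s₀ ∈ (classSet b p z).filter mv := by rw [hs₀]; exact mem_singleton_self _
    obtain ⟨hs₀c, hs₀mv⟩ := mem_filter.1 hs₀mem
    obtain ⟨ℓ₀, hℓ₀L, rfl⟩ := lev_of_mem hs₀c
    have hEb : classExp b p z = -(M : ℤ) + 2 := by have := hcnt; rw [hE', hc1] at this; push_cast at this; omega
    have hR2 := H5 z hz h1b (by rw [hνb, hEb])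
    have hS' : classTypeList (shift b j) p z = raiseAtList (classTypeList b p z) ℓ₀ := by
      rw [hSb, raiseAtList_range_map]
      unfold classTypeList
      rw [htop]
      refine List.map_congr_left fun ℓ hℓ => ?_
      have hℓL : ℓ ≤ L := by have := List.mem_range.1 hℓ; omega
      rw [hnew ℓ hℓL, raiseAt]
      by_cases hℓℓ : ℓ = ℓ₀
      · subst hℓℓ; rw [if_pos hs₀mv, if_pos rfl]
      · have hnot : ¬ mv (z + ℓ * p) := by
          intro h
          have : z + ℓ * p ∈ (classSet b p z).filter mv := mem_filter.2 ⟨LevelClass.level_mem b hz hL hL' hℓL, h⟩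
          rw [hs₀, mem_singleton] at this
          exact hℓℓ (LevelClass.level_injective hp0 z this)
        rw [if_neg hnot, if_neg hℓℓ, add_zero]
    rw [hS']
    exact Or.inl (isRaiseN_raiseAtList 2 T _ ℓ₀ (isRaiseN_two_of_isRaise2 hR2) (by rw [hlenb]; omega))
  · -- ### hit twice: `E_z(b) = −M + 1`, the `b`-list is a single raise (or the odd-centre `T`), raised twice more
    obtain ⟨s₀, s₁, hne, hpair⟩ := card_eq_two.1 hc2
    have hs₀mem : s₀ ∈ (classSet b p z).filter mv := by rw [hpair]; exact mem_insert_self _ _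
    have hs₁mem : s₁ ∈ (classSet b p z).filter mv := by rw [hpair]; exact mem_insert_of_mem (mem_singleton_self _)
    obtain ⟨hs₀c, hs₀mv⟩ := mem_filter.1 hs₀mem
    obtain ⟨hs₁c, hs₁mv⟩ := mem_filter.1 hs₁mem
    obtain ⟨ℓ₀, hℓ₀L, rfl⟩ := lev_of_mem hs₀c
    obtain ⟨ℓ₁, hℓ₁L, rfl⟩ := lev_of_mem hs₁c
    have hℓne : ℓ₀ ≠ ℓ₁ := fun h => hne (by rw [h])
    have hEb : classExp b p z = -(M : ℤ) + 1 := by have := hcnt; rw [hE', hc2] at this; push_cast at this; omega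
    have hS' : classTypeList (shift b j) p z = raiseAtList (raiseAtList (classTypeList b p z) ℓ₀) ℓ₁ := by
      rw [hSb, raiseAtList_range_map, raiseAtList_range_map]
      unfold classTypeList
      rw [htop]
      refine List.map_congr_left fun ℓ hℓ => ?_
      have hℓL : ℓ ≤ L := by have := List.mem_range.1 hℓ; omega
      rw [hnew ℓ hℓL, raiseAt, raiseAt]
      by_cases hℓ0 : ℓ = ℓ₀
      · subst hℓ0; rw [if_pos hs₀mv, if_neg hℓne, if_pos rfl]
      by_cases hℓ1 : ℓ = ℓ₁
      · subst hℓ1; rw [if_pos hs₁mv, if_pos rfl, if_neg hℓ0]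
      have hnot : ¬ mv (z + ℓ * p) := by
        intro h
        have : z + ℓ * p ∈ (classSet b p z).filter mv := mem_filter.2 ⟨LevelClass.level_mem b hz hL hL' hℓL, h⟩
        rw [hpair, mem_insert, mem_singleton] at this
        rcases this with h' | h'
        · exact hℓ0 (LevelClass.level_injective hp0 z h')
        · exact hℓ1 (LevelClass.level_injective hp0 z h')
      rw [if_neg hnot, if_neg hℓ1, if_neg hℓ0, add_zero]
    have hlen₀ : ℓ₀ < (classTypeList b p z).length := by rw [hlenb]; omega
    have hlen₁ : ℓ₁ < (raiseAtList (classTypeList b p z) ℓ₀).length := by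
      unfold raiseAtList; rw [List.length_mapIdx, hlenb]; omega
    rw [hS']
    rcases H4 z hz h1b (by rw [hνb, hEb]) with hr | ⟨hodd, hcen, hT⟩
    · exact Or.inl (isRaiseN_raiseAtList 2 T _ ℓ₁
        (isRaiseN_raiseAtList 1 T _ ℓ₀ (isRaiseN_one_of_isRaise hr) hlen₀) hlen₁)
    · refine Or.inr ⟨by rw [shift_zero b hj1]; exact hodd, by unfold CentreIn; rw [shift_zero b hj1]; exact hcen, ?_⟩
      rw [hT] at hlen₀ hlen₁ ⊢
      exact isRaiseN_raiseAtList 1 T _ ℓ₁ (isRaiseN_raiseAtList 0 T T ℓ₀ ((isRaiseN_zero_iff T T).2 rfl) hlen₀) hlen₁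

end Transport

/-! ## §3 The L5 frame of the record ray from the unshifted datum -/

/-- **`RecFrameL5 n p M T` from the clauses of `bRec n` alone** (`p ≤ 41n`, `1 ≤ n`, `M ≥ 6`). -/
theorem recFrameL5_of_unshifted {n p M : ℕ} {T : List ℤ} (hn : 1 ≤ n) (hprime : p.Prime) (hpn : p ≤ 41 * n) (hM : 6 ≤ M)
    (hC : LawA4Classes (bRec n) p M T) (hS : ShapeClause (bRec n) p M T) : RecFrameL5 n p M T := by
  haveI : Fact p.Prime := ⟨hprime⟩
  have hb : InPolytope (bRec n) := by rw [CellKit.bRec_eq_bLin]; exact CellKit.inPolytope_bLin (by omega)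
  have hb' : InPolytope (shift (bRec n) 7) := by rw [CellKit.bRec_eq_bLin]; exact CellKit.inPolytope_shift_bLin hn (by omega)
  have hpb : (p : ℤ) ≤ bRec n 0 := by
    rw [CellKit.bRec_eq_bLin, CellKit.bLin_zero]; push_cast; omega
  exact ⟨hC, lawA4Classes_shift (bRec n) hb hb' (by norm_num) le_rfl hpb hM hC,
    hS, shapeClause_shift (bRec n) hb hb' (by norm_num) le_rfl hpb hM hC hS⟩

end Summit.KontsevichZagierPeriods.Zeta5Search.SecondOrder

end
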